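import Summits.HodgeConjecture.HodgeConjecture.Theorems.Q8SymplecticPowersDeckEigenHodge
import Literature.AlgebraicGeometry.HodgeTheory.BettiTranscendentalPartK3TypeSchurProducts
import Literature.AlgebraicGeometry.Motives.HodgeStructureHodgeVectorBlockCanonical
import Literature.AlgebraicGeometry.Motives.HodgeStructureHodgeVectorProjector
import HarnessLib

/-!
# K2Q brick C-Q (part 3): the quaternion deck relations on the TRANSCENDENTAL PART of `H²(X; ℚ)`

Cell `hodge-nonav`, prover seat `hodge-nonav-20241-p1` (g20); programme K2Q (crux `PowersHodgeOfQuaternionCommutators`,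
stmt-HodgeConjecture-24191, route `Q8SymplecticPowers`; memo `PROGRAMME-K2Q-20241p1-g20.md`, brick C-Q (ii)). HELPER FILE
(`--supports stmt-HodgeConjecture-24191 --as helper`). Sorry-free; axioms standard.

For a smooth projective surface `X`, `H = hodge … hX 2` the Hodge structure on `V = H²(X(ℂ); ℚ)`, `N = (hodge exists_isReal_hodgeModel_holds hX 2).hodgeClasses 1` the rational
`(1,1)`-classes and, for ANY polarisation `ψ` of `H`, `T = N^{⊥ψ}` — Huybrechts' transcendental part, the minimal sub-Hodge structure
with `H^{2,0} ⊆ T_ℂ` (`BettiUniverse.isTranscendentalPart_iff_eq_orthogonal`), a complement of `N` (`Polarization.isCompl_hodgeClasses_orthogonal`):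
every cohomological self-map `σ^*` preserves `T` (morphisms of polarizable Hodge structures are block diagonal,
`Polarization.map_orthogonal_hodgeClasses_le`); and for a COHOMOLOGICAL QUATERNION DECK PAIR `τ, j` (`(τ^*)⁴ = 1`, `(j^*)² = (τ^*)²`,
`j^*τ^* = (τ^*)³j^*`, no `(2,0)`-class in the `+1`-eigenspace of `z = (τ^*)²` — the deck clause of the crux) the maps `a = τ^*|_T`,
`b = j^*|_T` satisfy the relations of the ENGINE `Q8CommutatorDegreeTwoCore`: `a² = b² = −1`, `ab = −ba` on `T` (because `ker(z − 1) ⊆ N`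
by `Q8SymplecticPowersDeckEigenHodge.eigenspace_pull_sq_le_hodgeClasses`, while `N ∩ T = 0`); and `T ≠ 0` as soon as `H^{2,0} ≠ 0`.

* `pull_mem_transcendental` — `x ∈ T ⇒ σ^* x ∈ T`;
* `pull_sq_apply_eq_neg_of_mem_transcendental` — `(τ^*)² x = −x` on `T`;
* `pull_sq_apply_eq_neg_of_mem_transcendental'` — `(j^*)² x = −x` on `T` (from `(j^*)² = (τ^*)²`);
* `pull_pull_eq_neg_of_mem_transcendental` — `j^*(τ^* x) = −τ^*(j^* x)` on `T`;
* `transcendental_ne_bot` — `T ≠ 0` if `H^{2,0}(X) ≠ 0`.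

Still to come in C-Q: `T = N^{⊥Q}` for the trace form `Q = tr ∘ cup` (so that the crux's `Uni` elements — `Q`-isometries fixing `N`
pointwise — preserve `T`), and `Q|_T` nondegenerate (Hodge–Riemann on `H^{2,0}`). Honest scope: bookkeeping; nothing here says HC,
HC_CM or HC_AV is proved.

References: D. Huybrechts, *Lectures on K3 Surfaces* (2016), Ch. 3 Def. 2.5, Lemma 3.1; C. Voisin, *Hodge Theory I* (2002), §7.3.1
Def. 7.22, Lemma 7.26, §7.3.2; C. Voisin, *Lectures on the Hodge and Grothendieck–Hodge conjectures for abelian varieties* (2025),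
Cor. 2.12 (morphisms are block diagonal).
-/

set_option linter.dupNamespace false

noncomputable section

open scoped TensorProduct
open CategoryTheory
open Literature.AlgebraicGeometry.Motives Literature.AlgebraicGeometry.HodgeTheory
open Literature.AlgebraicGeometry.HodgeTheory.BettiUniverse
open Literature.AlgebraicGeometry.Motives.HodgeStructure
open Summit.HodgeConjecture.HodgeConjecture.Theorems.Q8SymplecticPowersDeckEigenHodge

namespace Summit.HodgeConjecture.HodgeConjecture.Theorems.Q8SymplecticPowersTranscendentalPart

variable {X : SchemeOver ℂ}

/-- **Cohomological self-maps preserve the transcendental part**: for a smooth projective surface `X`, a morphism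
`σ : X ⟶ X`, any polarisation `ψ` of `H²(X)` and `x ∈ T = Hdg¹(H²X)^{⊥ψ}`: `σ^* x ∈ T` (`σ^*` is a morphism of the polarizable
Hodge structure `H²(X)`, hence block diagonal for `V = Hdg¹ ⊕ Hdg¹^⊥`). [cite: Voisin2025, Cor. 2.12]
[cite: VoisinHodgeI2002, §7.3.1 Def. 7.22 and Lemma 7.26] -/
theorem pull_mem_transcendental (hX : IsSmoothProjective 2 X)
    (ψ : Polarization (hodge exists_isReal_hodgeModel_holds hX 2)) (σ : X ⟶ X) {x : bettiCohomology X 2}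
    (hx : x ∈ ψ.form.orthogonal ((hodge exists_isReal_hodgeModel_holds hX 2).hodgeClasses 1)) :
    pull σ 2 x ∈ ψ.form.orthogonal ((hodge exists_isReal_hodgeModel_holds hX 2).hodgeClasses 1) := by
  haveI := finite hX 2
  have hle := Polarization.map_orthogonal_hodgeClasses_le ψ ψ (show (1 : ℤ) + 1 = ((2 : ℕ) : ℤ) by norm_num)
    (pullHodgeHom exists_isReal_hodgeModel_holds hodgePQ_independent_of_hodgeModel_holds hX hX σ 2)
  exact hle (Submodule.mem_map_of_mem hx)

/-- **`z = (τ^*)²` is `−1` on the transcendental part**: for `τ : X ⟶ X` with `(τ^*)⁴ = 1` on `H²(X; ℚ)` and no `(2,0)`-class in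
`ker(z_ℂ − 1)`, every `x ∈ T` has `(τ^*)² x = −x` (`z x + x ∈ ker(z − 1) ∩ T ⊆ Hdg¹ ∩ T = 0`).
[cite: Huybrechts2016K3, Ch. 3 Def. 2.5 and Lemma 3.1] [cite: VoisinHodgeI2002, §7.3.2] -/
theorem pull_sq_apply_eq_neg_of_mem_transcendental (hX : IsSmoothProjective 2 X)
    (ψ : Polarization (hodge exists_isReal_hodgeModel_holds hX 2)) (τ : X ⟶ X) (h4 : pull τ 2 ^ 4 = 1)
    (h20 : Module.finrank ℂ ↥(Module.End.eigenspace ((pull τ 2 ^ 2).baseChange ℂ) 1 ⊓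
      (hodge exists_isReal_hodgeModel_holds hX 2).piece 2 0) = 0)
    {x : bettiCohomology X 2}
    (hx : x ∈ ψ.form.orthogonal ((hodge exists_isReal_hodgeModel_holds hX 2).hodgeClasses 1)) :
    (pull τ 2 ^ 2) x = -x := by
  haveI := finite hX 2
  -- `y := z x + x` is `z`-fixed and lies in `T`
  have hzz : (pull τ 2 ^ 2) ((pull τ 2 ^ 2) x) = x := by
    rw [← Module.End.mul_apply, ← pow_add, show 2 + 2 = 4 by rfl, h4, Module.End.one_apply]
  have hyT : (pull τ 2 ^ 2) x + x ∈ ψ.form.orthogonal ((hodge exists_isReal_hodgeModel_holds hX 2).hodgeClasses 1) := by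
    refine Submodule.add_mem _ ?_ hx
    rw [pow_two, Module.End.mul_apply]
    exact pull_mem_transcendental hX ψ τ (pull_mem_transcendental hX ψ τ hx)
  have hyfix : (pull τ 2 ^ 2) ((pull τ 2 ^ 2) x + x) = (pull τ 2 ^ 2) x + x := by
    rw [map_add, hzz, add_comm]
  have hyN : (pull τ 2 ^ 2) x + x ∈ (hodge exists_isReal_hodgeModel_holds hX 2).hodgeClasses 1 :=
    eigenspace_pull_sq_le_hodgeClasses hX τ h20 (Module.End.mem_eigenspace_iff.2 (by rw [one_smul]; exact hyfix))
  have hy0 : (pull τ 2 ^ 2) x + x = 0 := by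
    have hmem : (pull τ 2 ^ 2) x + x ∈ (hodge exists_isReal_hodgeModel_holds hX 2).hodgeClasses 1 ⊓ ψ.form.orthogonal ((hodge exists_isReal_hodgeModel_holds hX 2).hodgeClasses 1) :=
      Submodule.mem_inf.2 ⟨hyN, hyT⟩
    rw [(ψ.isCompl_hodgeClasses_orthogonal (show (1 : ℤ) + 1 = ((2 : ℕ) : ℤ) by norm_num)).inf_eq_bot] at hmem
    exact (Submodule.mem_bot ℚ).1 hmem
  exact eq_neg_of_add_eq_zero_left hy0

/-- **`(j^*)² = −1` on the transcendental part** for a cohomological quaternion deck pair (`(j^*)² = (τ^*)²`).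
[cite: Huybrechts2016K3, Ch. 3 Def. 2.5 and Lemma 3.1] -/
theorem pull_sq_apply_eq_neg_of_mem_transcendental' (hX : IsSmoothProjective 2 X)
    (ψ : Polarization (hodge exists_isReal_hodgeModel_holds hX 2)) (τ j : X ⟶ X) (h4 : pull τ 2 ^ 4 = 1)
    (hj : pull j 2 ^ 2 = pull τ 2 ^ 2)
    (h20 : Module.finrank ℂ ↥(Module.End.eigenspace ((pull τ 2 ^ 2).baseChange ℂ) 1 ⊓
      (hodge exists_isReal_hodgeModel_holds hX 2).piece 2 0) = 0)
    {x : bettiCohomology X 2}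
    (hx : x ∈ ψ.form.orthogonal ((hodge exists_isReal_hodgeModel_holds hX 2).hodgeClasses 1)) :
    (pull j 2 ^ 2) x = -x := by
  rw [hj]
  exact pull_sq_apply_eq_neg_of_mem_transcendental hX ψ τ h4 h20 hx

/-- **`j^* τ^* = −τ^* j^*` on the transcendental part** for a cohomological quaternion deck pair
(`j^*τ^* = (τ^*)³j^* = τ^* ∘ z ∘ j^*` and `z = −1` on `T ∋ j^* x`). [cite: Huybrechts2016K3, Ch. 3 Def. 2.5 and Lemma 3.1] -/
theorem pull_pull_eq_neg_of_mem_transcendental (hX : IsSmoothProjective 2 X)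
    (ψ : Polarization (hodge exists_isReal_hodgeModel_holds hX 2)) (τ j : X ⟶ X) (h4 : pull τ 2 ^ 4 = 1)
    (hrel : pull j 2 * pull τ 2 = pull τ 2 ^ 3 * pull j 2)
    (h20 : Module.finrank ℂ ↥(Module.End.eigenspace ((pull τ 2 ^ 2).baseChange ℂ) 1 ⊓
      (hodge exists_isReal_hodgeModel_holds hX 2).piece 2 0) = 0)
    {x : bettiCohomology X 2}
    (hx : x ∈ ψ.form.orthogonal ((hodge exists_isReal_hodgeModel_holds hX 2).hodgeClasses 1)) :
    pull j 2 (pull τ 2 x) = -(pull τ 2 (pull j 2 x)) := by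
  have h := LinearMap.congr_fun hrel x
  rw [Module.End.mul_apply, Module.End.mul_apply, pow_succ', Module.End.mul_apply,
    pull_sq_apply_eq_neg_of_mem_transcendental hX ψ τ h4 h20 (pull_mem_transcendental hX ψ j hx), map_neg] at h
  exact h

/-- **The transcendental part is non-zero when `H^{2,0}(X) ≠ 0`** (`H^{2,0} ⊆ T_ℂ`, Huybrechts' Def. 2.5).
[cite: Huybrechts2016K3, Ch. 3 Def. 2.5 and Lemma 3.1] -/
theorem transcendental_ne_bot (hX : IsSmoothProjective 2 X)
    (ψ : Polarization (hodge exists_isReal_hodgeModel_holds hX 2))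
    (hpg : (hodge exists_isReal_hodgeModel_holds hX 2).piece 2 0 ≠ ⊥) :
    ψ.form.orthogonal ((hodge exists_isReal_hodgeModel_holds hX 2).hodgeClasses 1) ≠ ⊥ := by
  haveI := finite hX 2
  obtain ⟨T, hT⟩ := ψ.exists_subHodgeStructure_eq_orthogonal_hodgeClasses (show (1 : ℤ) + 1 = ((2 : ℕ) : ℤ) by norm_num)
  have htr := (isTranscendentalPart_iff_eq_orthogonal exists_isReal_hodgeModel_holds hX ψ T).2 hT
  intro hbot
  apply hpg
  have hle := htr.piece_le
  rw [hT, hbot, Submodule.baseChange_bot] at hle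
  exact le_bot_iff.1 hle

/-- **The deck quotient `τ^* ∘ j^*` also preserves `T`, and on `T` the four maps `1, τ^*, j^*, τ^*j^*` satisfy the quaternion
table** — packaged form of the relations for the ENGINE: `a := τ^*|_T`, `b := j^*|_T` with `a(a x) = −x`, `b(b x) = −x`,
`a(b x) = −b(a x)`. [cite: Huybrechts2016K3, Ch. 3 Def. 2.5 and Lemma 3.1] -/
theorem quaternion_relations_on_transcendental (hX : IsSmoothProjective 2 X)
    (ψ : Polarization (hodge exists_isReal_hodgeModel_holds hX 2)) (τ j : X ⟶ X) (h4 : pull τ 2 ^ 4 = 1)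
    (hj : pull j 2 ^ 2 = pull τ 2 ^ 2) (hrel : pull j 2 * pull τ 2 = pull τ 2 ^ 3 * pull j 2)
    (h20 : Module.finrank ℂ ↥(Module.End.eigenspace ((pull τ 2 ^ 2).baseChange ℂ) 1 ⊓
      (hodge exists_isReal_hodgeModel_holds hX 2).piece 2 0) = 0) :
    (∀ x ∈ ψ.form.orthogonal ((hodge exists_isReal_hodgeModel_holds hX 2).hodgeClasses 1),
        pull τ 2 (pull τ 2 x) = -x) ∧
      (∀ x ∈ ψ.form.orthogonal ((hodge exists_isReal_hodgeModel_holds hX 2).hodgeClasses 1),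
        pull j 2 (pull j 2 x) = -x) ∧
      (∀ x ∈ ψ.form.orthogonal ((hodge exists_isReal_hodgeModel_holds hX 2).hodgeClasses 1),
        pull τ 2 (pull j 2 x) = -(pull j 2 (pull τ 2 x))) := by
  refine ⟨fun x hx ↦ ?_, fun x hx ↦ ?_, fun x hx ↦ ?_⟩
  · have h := pull_sq_apply_eq_neg_of_mem_transcendental hX ψ τ h4 h20 hx
    rwa [pow_two, Module.End.mul_apply] at h
  · have h := pull_sq_apply_eq_neg_of_mem_transcendental' hX ψ τ j h4 hj h20 hx
    rwa [pow_two, Module.End.mul_apply] at h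
  · rw [pull_pull_eq_neg_of_mem_transcendental hX ψ τ j h4 hrel h20 hx, neg_neg]

end Summit.HodgeConjecture.HodgeConjecture.Theorems.Q8SymplecticPowersTranscendentalPart

end
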